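import Summits.ValiantsHypothesis.ValiantsHypothesis.Theorems.LacunarySymmetroidMatrixDescartesDoorA26WallBubblingNullEndAsymptotics
import Summits.ValiantsHypothesis.ValiantsHypothesis.Theorems.LacunarySymmetroidMatrixDescartesCensusRealExponents

/-!
# Wall bubbling for `DoorA26` — obligation (R), the END profile read POSITIVELY: a null-end pencil with simple zeros IS in the twenty-locus

HONEST FRAMING.  Helper theorems for the line `Cruxes/DoorA26/Lines/wall_bubbling.lean` (crux stmt-ValiantsHypothesis-19979 `DoorA26`; OPEN, typed,
never asserted), W2 seat val-sym-door-p1 g16; obligation (R) `stub_chamberRigidity` (closure points of the twenty-locus inside a chamber lie in it).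
Def-free; nothing here bears on `DoorA26`, `MatrixDescartes` (stmt-ValiantsHypothesis-18050) or `VP ≠ VNP`; registers unchanged.

THE POINT.  The located residual of (R)'s multi-cluster branch (W2 g16 memo §8–§9) consists of END profiles; in the extreme one, `(1,19)`, the big
cluster's limit at the interior point `δ⋆` is a pencil ON THE SAME SUPPORT whose lowest letter is NULL (`det W₀ = 0`, value `2δ₀` dead) and non-zero (value
`δ₀+δ₁` alive), with 19 zeros among its 20 alive values.  If those zeros are SIMPLE (20 abscissae of alternating sign in the variable `t = log x`), then
un-nulling `W₀ ↦ W₀ + η·1` for a suitable small `η` produces a 21st alternation at `t → −∞` (there `det P_η(t) e^{−2δ₀ t} → det(W₀ + η·1) = η tr W₀ + η²`,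
sign free), so the support `δ⋆` carries a pencil with 20 zeros: **`δ⋆ ∈ TwentyLocus`** — which is exactly what (R) asks at `δ⋆`.  So the `(1,19)` END profile
with simple limit zeros is NOT an obstruction to (R); what remains there is MULTIPLICITY (colliding limit zeros).  The mirror `(19,1)` is the same at `t → +∞`
(`mem_twentyLocus_of_nullTop_alternations`), and `(1,18,1)` uses both ends (`mem_twentyLocus_of_nullNull_alternations`).  Real-exponent currency: the
line's `Bubbling.TwentyLocus` via `Census.RealExp.ncard_rpow_eq_ncard_exp`, finiteness via `Census.RealExp.le_ncard_of_brackets`; part 1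
(`…WallBubblingNullEndAsymptotics.lean`) supplies the un-nulling lemmas and the end asymptotics.  The integer-exponent twin for the refutation side is
`Theorems/DoorA26/Negative/DoorA26FalseOfNullNullEighteen.lean`.

[folklore] continuity + intermediate values; [this work] the wiring.
-/

-- `Summit.ValiantsHypothesis.ValiantsHypothesis.…` repeats a component by the D-0017 layout
-- (single-conjunct summit), which the `dupNamespace` linter flags; the name is mandated.
set_option linter.dupNamespace false

namespace Summit.ValiantsHypothesis.ValiantsHypothesis.Theorems.LacunarySymmetroidMatrixDescartes.WallBubbling

open Finset Filter Topology
open Bubbling (TwentyLocus)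
open Census.RealExp (ncard_rpow_eq_ncard_exp le_ncard_of_brackets continuous_det_expPencil)

/-! ## §1 One more alternation at the bottom (log time: a very negative new abscissa) -/

/-- **Bottom extension (log time).**  Null non-zero bottom letter, strictly increasing exponents, `N+1` increasing abscissae with non-vanishing `det` values of
alternating sign ⇒ after replacing `S₀` by `S₀ + η·1` for a suitable small `η` there are `N+2` increasing abscissae with alternating non-zero values. [this work] -/
theorem extend_bot_exp (δ : Fin 6 → ℝ) (hd : StrictMono δ) (S : Fin 6 → Matrix (Fin 2) (Fin 2) ℝ)
    (h0 : (S 0).det = 0) (htr : (S 0).trace ≠ 0) {N : ℕ} (τ : Fin (N + 1) → ℝ) (hτ : StrictMono τ)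
    (hne : ∀ j, (∑ l, Real.exp (δ l * τ j) • S l).det ≠ 0)
    (halt : ∀ j : Fin N, (∑ l, Real.exp (δ l * τ j.castSucc) • S l).det * (∑ l, Real.exp (δ l * τ j.succ) • S l).det < 0) :
    ∃ (η : ℝ) (τ' : Fin (N + 2) → ℝ), StrictMono τ' ∧
      (∀ j, (∑ l, Real.exp (δ l * τ' j) • Function.update S 0 (S 0 + η • (1 : Matrix (Fin 2) (Fin 2) ℝ)) l).det ≠ 0) ∧
      (∀ j : Fin (N + 1),
        (∑ l, Real.exp (δ l * τ' j.castSucc) • Function.update S 0 (S 0 + η • (1 : Matrix (Fin 2) (Fin 2) ℝ)) l).det *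
        (∑ l, Real.exp (δ l * τ' j.succ) • Function.update S 0 (S 0 + η • (1 : Matrix (Fin 2) (Fin 2) ℝ)) l).det < 0) := by
  set f : (Fin 6 → Matrix (Fin 2) (Fin 2) ℝ) → ℝ → ℝ := fun T t => (∑ l, Real.exp (δ l * t) • T l).det with hf
  set U : ℝ → Fin 6 → Matrix (Fin 2) (Fin 2) ℝ := fun η => Function.update S 0 (S 0 + η • (1 : Matrix (Fin 2) (Fin 2) ℝ)) with hU
  set aF : ℝ := f S (τ 0) with haF
  have haF0 : aF ≠ 0 := hne _
  set ηof : ℝ → ℝ := fun s => -(s * ((S 0).trace * aF)) with hηof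
  have hη0 : Tendsto ηof (𝓝[>] 0) (𝓝 0) := by
    have : Tendsto ηof (𝓝 0) (𝓝 (ηof 0)) := by
      have hc : Continuous ηof := by rw [hηof]; fun_prop
      exact hc.tendsto 0
    rw [show ηof 0 = 0 by simp [hηof]] at this
    exact this.mono_left nhdsWithin_le_nhds
  have hpers : ∀ j, ∀ᶠ s in 𝓝[>] (0 : ℝ), 0 < f S (τ j) * f (U (ηof s)) (τ j) := by
    intro j
    have hc : Tendsto (fun η => f (U η) (τ j)) (𝓝 0) (𝓝 (f (U 0) (τ j))) :=
      (continuous_det_expPencil_update δ S 0 (τ j)).tendsto 0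
    have hU0 : f (U 0) (τ j) = f S (τ j) := by simp [hU, hf]
    rw [hU0] at hc
    have h2 : Tendsto (fun s => f S (τ j) * f (U (ηof s)) (τ j)) (𝓝[>] 0) (𝓝 (f S (τ j) * f S (τ j))) :=
      ((hc.comp hη0).const_mul _)
    exact h2.eventually (lt_mem_nhds (mul_self_pos.mpr (hne j)))
  have hnew : ∀ᶠ s in 𝓝[>] (0 : ℝ), (U (ηof s) 0).det * aF < 0 := by
    have hdet : ∀ s, (U (ηof s) 0).det * aF = s * (-( ((S 0).trace * aF) ^ 2) + s * (((S 0).trace * aF) ^ 2 * aF)) := by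
      intro s
      simp only [hU, Function.update_self, LacunarySymmetroidMatrixDescartes.TailGraft.det_add_smul_one_two, h0, hηof]
      ring
    simp_rw [hdet]
    have hq : Tendsto (fun s : ℝ => -( ((S 0).trace * aF) ^ 2) + s * (((S 0).trace * aF) ^ 2 * aF)) (𝓝[>] 0)
        (𝓝 (-( ((S 0).trace * aF) ^ 2) + 0 * (((S 0).trace * aF) ^ 2 * aF))) := by
      have hc : Continuous (fun s : ℝ => -( ((S 0).trace * aF) ^ 2) + s * (((S 0).trace * aF) ^ 2 * aF)) := by fun_prop
      exact (hc.tendsto 0).mono_left nhdsWithin_le_nhds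
    have hlim : -( ((S 0).trace * aF) ^ 2) + 0 * (((S 0).trace * aF) ^ 2 * aF) < 0 := by
      have : 0 < ((S 0).trace * aF) ^ 2 := by positivity
      linarith
    have hev := hq.eventually (gt_mem_nhds hlim)
    filter_upwards [hev, self_mem_nhdsWithin] with s hs hs0
    exact mul_neg_of_pos_of_neg hs0 hs
  obtain ⟨s, hs_pers, hs_new⟩ := (((Finset.eventually_all Finset.univ).mpr fun j _ => hpers j).and hnew).exists
  set η := ηof s with hηdef
  have hpers' : ∀ j, 0 < f S (τ j) * f (U η) (τ j) := fun j => hs_pers j (Finset.mem_univ j)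
  have hD0 : (U η 0).det ≠ 0 := by
    intro h0'; rw [h0', zero_mul] at hs_new; exact lt_irrefl _ hs_new
  -- a very negative abscissa with the sign of det(U η 0)
  have hbot := tendsto_det_expPencil_bot δ hd (U η)
  have hev1 : ∀ᶠ x in atBot, 0 < f (U η) x * (U η 0).det := by
    have h1 : Tendsto (fun x : ℝ => (f (U η) x * Real.exp (-(2 * δ 0 * x))) * (U η 0).det) atBot (𝓝 ((U η 0).det * (U η 0).det)) :=
      hbot.mul_const _
    have h2 := h1.eventually (lt_mem_nhds (mul_self_pos.mpr hD0))
    filter_upwards [h2] with x hx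
    have hxpow : 0 < Real.exp (-(2 * δ 0 * x)) := Real.exp_pos _
    have : f (U η) x * (U η 0).det = (f (U η) x * Real.exp (-(2 * δ 0 * x)) * (U η 0).det) / Real.exp (-(2 * δ 0 * x)) := by
      field_simp
    rw [this]
    exact div_pos hx hxpow
  obtain ⟨x, hx_sign, hx_lt⟩ := (hev1.and (eventually_lt_atBot (τ 0))).exists
  refine ⟨η, Fin.cons x τ, ?_, ?_, ?_⟩
  · intro i j hij
    induction i using Fin.cases with
    | zero =>
      induction j using Fin.cases with
      | zero => exact (lt_irrefl _ hij).elim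
      | succ j =>
        simp only [Fin.cons_zero, Fin.cons_succ]
        exact hx_lt.trans_le (hτ.monotone (Fin.zero_le j))
    | succ i =>
      induction j using Fin.cases with
      | zero => exact absurd hij (not_lt.2 (Fin.zero_le _))
      | succ j =>
        simp only [Fin.cons_succ]
        exact hτ (Fin.succ_lt_succ_iff.1 hij)
  · intro j
    induction j using Fin.cases with
    | zero =>
      simp only [Fin.cons_zero]
      intro h0'
      have : f (U η) x = 0 := h0'
      rw [this, zero_mul] at hx_sign; exact lt_irrefl _ hx_sign
    | succ j =>
      simp only [Fin.cons_succ]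
      intro h0'
      have hz : f (U η) (τ j) = 0 := h0'
      have := hpers' j
      rw [hz, mul_zero] at this; exact lt_irrefl _ this
  · intro j
    induction j using Fin.cases with
    | zero =>
      have h1 : (Fin.cons x τ : Fin (N + 2) → ℝ) (0 : Fin (N + 1)).castSucc = x := rfl
      have h2 : (Fin.cons x τ : Fin (N + 2) → ℝ) (0 : Fin (N + 1)).succ = τ 0 := rfl
      rw [h1, h2, mul_comm]
      exact NullEnd.neg_of_sign_chain (hpers' 0) hs_new hx_sign
    | succ i =>
      have h1 : (Fin.cons x τ : Fin (N + 2) → ℝ) i.succ.castSucc = τ i.castSucc := by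
        rw [← Fin.succ_castSucc]; exact Fin.cons_succ _ _ _
      have h2 : (Fin.cons x τ : Fin (N + 2) → ℝ) i.succ.succ = τ i.succ := Fin.cons_succ _ _ _
      rw [h1, h2]
      exact NullEnd.neg_of_sign_transfer (hpers' i.castSucc) (hpers' i.succ) (halt i)

/-! ## §2 One more alternation at the top (log time: a very large new abscissa) -/

/-- **Top extension (log time).** [this work] -/
theorem extend_top_exp (δ : Fin 6 → ℝ) (hd : StrictMono δ) (S : Fin 6 → Matrix (Fin 2) (Fin 2) ℝ)
    (h5 : (S 5).det = 0) (htr : (S 5).trace ≠ 0) {N : ℕ} (τ : Fin (N + 1) → ℝ) (hτ : StrictMono τ)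
    (hne : ∀ j, (∑ l, Real.exp (δ l * τ j) • S l).det ≠ 0)
    (halt : ∀ j : Fin N, (∑ l, Real.exp (δ l * τ j.castSucc) • S l).det * (∑ l, Real.exp (δ l * τ j.succ) • S l).det < 0) :
    ∃ (η : ℝ) (τ' : Fin (N + 2) → ℝ), StrictMono τ' ∧
      (∀ j, (∑ l, Real.exp (δ l * τ' j) • Function.update S 5 (S 5 + η • (1 : Matrix (Fin 2) (Fin 2) ℝ)) l).det ≠ 0) ∧
      (∀ j : Fin (N + 1),
        (∑ l, Real.exp (δ l * τ' j.castSucc) • Function.update S 5 (S 5 + η • (1 : Matrix (Fin 2) (Fin 2) ℝ)) l).det *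
        (∑ l, Real.exp (δ l * τ' j.succ) • Function.update S 5 (S 5 + η • (1 : Matrix (Fin 2) (Fin 2) ℝ)) l).det < 0) := by
  set f : (Fin 6 → Matrix (Fin 2) (Fin 2) ℝ) → ℝ → ℝ := fun T t => (∑ l, Real.exp (δ l * t) • T l).det with hf
  set U : ℝ → Fin 6 → Matrix (Fin 2) (Fin 2) ℝ := fun η => Function.update S 5 (S 5 + η • (1 : Matrix (Fin 2) (Fin 2) ℝ)) with hU
  set aL : ℝ := f S (τ (Fin.last N)) with haL
  have haL0 : aL ≠ 0 := hne _
  set ηof : ℝ → ℝ := fun s => -(s * ((S 5).trace * aL)) with hηof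
  have hη0 : Tendsto ηof (𝓝[>] 0) (𝓝 0) := by
    have : Tendsto ηof (𝓝 0) (𝓝 (ηof 0)) := by
      have hc : Continuous ηof := by rw [hηof]; fun_prop
      exact hc.tendsto 0
    rw [show ηof 0 = 0 by simp [hηof]] at this
    exact this.mono_left nhdsWithin_le_nhds
  have hpers : ∀ j, ∀ᶠ s in 𝓝[>] (0 : ℝ), 0 < f S (τ j) * f (U (ηof s)) (τ j) := by
    intro j
    have hc : Tendsto (fun η => f (U η) (τ j)) (𝓝 0) (𝓝 (f (U 0) (τ j))) :=
      (continuous_det_expPencil_update δ S 5 (τ j)).tendsto 0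
    have hU0 : f (U 0) (τ j) = f S (τ j) := by simp [hU, hf]
    rw [hU0] at hc
    have h2 : Tendsto (fun s => f S (τ j) * f (U (ηof s)) (τ j)) (𝓝[>] 0) (𝓝 (f S (τ j) * f S (τ j))) :=
      ((hc.comp hη0).const_mul _)
    exact h2.eventually (lt_mem_nhds (mul_self_pos.mpr (hne j)))
  have hnew : ∀ᶠ s in 𝓝[>] (0 : ℝ), (U (ηof s) 5).det * aL < 0 := by
    have hdet : ∀ s, (U (ηof s) 5).det * aL = s * (-( ((S 5).trace * aL) ^ 2) + s * (((S 5).trace * aL) ^ 2 * aL)) := by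
      intro s
      simp only [hU, Function.update_self, LacunarySymmetroidMatrixDescartes.TailGraft.det_add_smul_one_two, h5, hηof]
      ring
    simp_rw [hdet]
    have hq : Tendsto (fun s : ℝ => -( ((S 5).trace * aL) ^ 2) + s * (((S 5).trace * aL) ^ 2 * aL)) (𝓝[>] 0)
        (𝓝 (-( ((S 5).trace * aL) ^ 2) + 0 * (((S 5).trace * aL) ^ 2 * aL))) := by
      have hc : Continuous (fun s : ℝ => -( ((S 5).trace * aL) ^ 2) + s * (((S 5).trace * aL) ^ 2 * aL)) := by fun_prop
      exact (hc.tendsto 0).mono_left nhdsWithin_le_nhds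
    have hlim : -( ((S 5).trace * aL) ^ 2) + 0 * (((S 5).trace * aL) ^ 2 * aL) < 0 := by
      have : 0 < ((S 5).trace * aL) ^ 2 := by positivity
      linarith
    have hev := hq.eventually (gt_mem_nhds hlim)
    filter_upwards [hev, self_mem_nhdsWithin] with s hs hs0
    exact mul_neg_of_pos_of_neg hs0 hs
  obtain ⟨s, hs_pers, hs_new⟩ := (((Finset.eventually_all Finset.univ).mpr fun j _ => hpers j).and hnew).exists
  set η := ηof s with hηdef
  have hpers' : ∀ j, 0 < f S (τ j) * f (U η) (τ j) := fun j => hs_pers j (Finset.mem_univ j)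
  have hD0 : (U η 5).det ≠ 0 := by
    intro h0'; rw [h0', zero_mul] at hs_new; exact lt_irrefl _ hs_new
  have htop := tendsto_det_expPencil_top δ hd (U η)
  have hev1 : ∀ᶠ x in atTop, 0 < f (U η) x * (U η 5).det := by
    have h1 : Tendsto (fun x : ℝ => (f (U η) x * Real.exp (-(2 * δ 5 * x))) * (U η 5).det) atTop (𝓝 ((U η 5).det * (U η 5).det)) :=
      htop.mul_const _
    have h2 := h1.eventually (lt_mem_nhds (mul_self_pos.mpr hD0))
    filter_upwards [h2] with x hx
    have hxpow : 0 < Real.exp (-(2 * δ 5 * x)) := Real.exp_pos _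
    have : f (U η) x * (U η 5).det = (f (U η) x * Real.exp (-(2 * δ 5 * x)) * (U η 5).det) / Real.exp (-(2 * δ 5 * x)) := by
      field_simp
    rw [this]
    exact div_pos hx hxpow
  obtain ⟨x, hx_sign, hx_gt⟩ := (hev1.and (eventually_gt_atTop (τ (Fin.last N)))).exists
  refine ⟨η, Fin.snoc τ x, ?_, ?_, ?_⟩
  · intro i j hij
    induction j using Fin.lastCases with
    | last =>
      induction i using Fin.lastCases with
      | last => exact absurd hij (lt_irrefl _)
      | cast i =>
        simp only [Fin.snoc_castSucc, Fin.snoc_last]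
        exact (hτ.monotone (Fin.le_last i)).trans_lt hx_gt
    | cast j =>
      induction i using Fin.lastCases with
      | last => exact absurd ((Fin.castSucc_lt_last j).trans hij) (lt_irrefl _)
      | cast i =>
        simp only [Fin.snoc_castSucc]
        exact hτ (Fin.castSucc_lt_castSucc_iff.mp hij)
  · intro j
    induction j using Fin.lastCases with
    | last =>
      simp only [Fin.snoc_last]
      intro h0'
      have : f (U η) x = 0 := h0'
      rw [this, zero_mul] at hx_sign; exact lt_irrefl _ hx_sign
    | cast j =>
      simp only [Fin.snoc_castSucc]
      intro h0'
      have hz : f (U η) (τ j) = 0 := h0'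
      have := hpers' j
      rw [hz, mul_zero] at this; exact lt_irrefl _ this
  · intro j
    induction j using Fin.lastCases with
    | last =>
      have h1 : (Fin.snoc τ x : Fin (N + 2) → ℝ) (Fin.last N).castSucc = τ (Fin.last N) := Fin.snoc_castSucc _ _ _
      have h2 : (Fin.snoc τ x : Fin (N + 2) → ℝ) (Fin.last N).succ = x := by
        rw [Fin.succ_last]; exact Fin.snoc_last _ _
      rw [h1, h2]
      exact NullEnd.neg_of_sign_chain (hpers' (Fin.last N)) hs_new hx_sign
    | cast j =>
      have h1 : (Fin.snoc τ x : Fin (N + 2) → ℝ) j.castSucc.castSucc = τ j.castSucc := Fin.snoc_castSucc _ _ _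
      have h2 : (Fin.snoc τ x : Fin (N + 2) → ℝ) j.castSucc.succ = τ j.succ := by
        rw [Fin.succ_castSucc]; exact Fin.snoc_castSucc _ _ _
      rw [h1, h2]
      exact NullEnd.neg_of_sign_transfer (hpers' j.castSucc) (hpers' j.succ) (halt j)

/-! ## §3 Alternations ⇒ membership in the twenty-locus -/

/-- `N + 1` increasing abscissae with alternating `det` values give `N` zeros: the zero set in log time is finite with `≥ N` elements. [folklore] -/
theorem le_ncard_of_alternations_exp (δ : Fin 6 → ℝ) (S : Fin 6 → Matrix (Fin 2) (Fin 2) ℝ) {N : ℕ} (hN : 0 < N)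
    (τ : Fin (N + 1) → ℝ) (hτ : StrictMono τ)
    (halt : ∀ j : Fin N, (∑ l, Real.exp (δ l * τ j.castSucc) • S l).det * (∑ l, Real.exp (δ l * τ j.succ) • S l).det < 0) :
    {t : ℝ | (∑ l, Real.exp (δ l * t) • S l).det = 0}.Finite ∧ N ≤ {t : ℝ | (∑ l, Real.exp (δ l * t) • S l).det = 0}.ncard := by
  classical
  -- finiteness from one bracket
  obtain ⟨hfin, -⟩ := le_ncard_of_brackets (m := 2) (K := 6) δ S (n := 1) Nat.one_pos
    (a := fun _ => τ (⟨0, by omega⟩ : Fin N).castSucc) (b := fun _ => τ (⟨0, by omega⟩ : Fin N).succ)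
    (fun _ => hτ Fin.castSucc_lt_succ) (fun i j hij => absurd hij (by omega)) (fun _ => halt ⟨0, by omega⟩)
  refine ⟨hfin, ?_⟩
  -- one zero in each gap, all distinct
  have hzeros : ∀ j : Fin N, ∃ w ∈ Set.Ioo (τ j.castSucc) (τ j.succ), (∑ l, Real.exp (δ l * w) • S l).det = 0 := by
    intro j
    have hlt : τ j.castSucc < τ j.succ := hτ (Fin.castSucc_lt_succ (i := j))
    have hcont := (continuous_det_expPencil (m := 2) (K := 6) δ S).continuousOn (s := Set.Icc (τ j.castSucc) (τ j.succ))
    rcases mul_neg_iff.mp (halt j) with ⟨h1, h2⟩ | ⟨h1, h2⟩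
    · obtain ⟨w, hw, hw0⟩ := intermediate_value_Ioo' hlt.le hcont ⟨h2, h1⟩
      exact ⟨w, hw, hw0⟩
    · obtain ⟨w, hw, hw0⟩ := intermediate_value_Ioo hlt.le hcont ⟨h1, h2⟩
      exact ⟨w, hw, hw0⟩
  choose w hwmem hw0 using hzeros
  have hwmono : StrictMono w := by
    intro i j hij
    have h1 := (hwmem i).2
    have h2 := (hwmem j).1
    have h3 : τ i.succ ≤ τ j.castSucc := hτ.monotone (by
      rw [Fin.le_def, Fin.val_succ, Fin.val_castSucc]; exact hij)
    linarith
  have hsub : Set.range w ⊆ {t : ℝ | (∑ l, Real.exp (δ l * t) • S l).det = 0} := by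
    rintro _ ⟨j, rfl⟩; exact hw0 j
  calc N = (Set.range w).ncard := by
        rw [Set.ncard_range_of_injective hwmono.injective, Nat.card_eq_fintype_card, Fintype.card_fin]
    _ ≤ _ := Set.ncard_le_ncard hsub hfin

/-- **NULL-END NINETEEN WITH SIMPLE ZEROS ⇒ THE SUPPORT IS IN THE TWENTY-LOCUS** (bottom version).  Strictly increasing real exponents `δ`, symmetric letters with
`det S₀ = 0 ≠ tr S₀`, and `20` increasing log-time abscissae at which `det Σ e^{δ_l t} S_l` takes non-zero values of alternating sign.  Then `δ ∈ TwentyLocus`.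
This is the positive reading of the `(1,19)` END profile for obligation (R). [this work] -/
theorem mem_twentyLocus_of_nullBot_alternations (δ : Fin 6 → ℝ) (hd : StrictMono δ) (S : Fin 6 → Matrix (Fin 2) (Fin 2) ℝ)
    (hS : ∀ l, (S l).IsSymm) (h0 : (S 0).det = 0) (htr : (S 0).trace ≠ 0)
    (τ : Fin 20 → ℝ) (hτ : StrictMono τ)
    (halt : ∀ j : Fin 19, (∑ l, Real.exp (δ l * τ j.castSucc) • S l).det * (∑ l, Real.exp (δ l * τ j.succ) • S l).det < 0) :
    δ ∈ TwentyLocus := by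
  have hne : ∀ j : Fin 20, (∑ l, Real.exp (δ l * τ j) • S l).det ≠ 0 := by
    intro j
    by_cases hj : j = Fin.last 19
    · subst hj
      have := halt (Fin.last 18)
      rw [Fin.succ_last] at this
      intro hz; rw [hz, mul_zero] at this; exact lt_irrefl _ this
    · obtain ⟨i, rfl⟩ := Fin.exists_castSucc_eq.mpr hj
      have := halt i
      intro hz; rw [hz, zero_mul] at this; exact lt_irrefl _ this
  obtain ⟨η, τ', hτ', -, halt'⟩ := extend_bot_exp δ hd S h0 htr τ hτ hne halt
  set S' := Function.update S 0 (S 0 + η • (1 : Matrix (Fin 2) (Fin 2) ℝ)) with hS'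
  refine ⟨S', NullEnd.isSymm_update S hS 0 η, ?_⟩
  rw [ncard_rpow_eq_ncard_exp]
  exact (le_ncard_of_alternations_exp δ S' (by norm_num) τ' hτ' halt').2

/-- **NULL-END NINETEEN WITH SIMPLE ZEROS ⇒ THE SUPPORT IS IN THE TWENTY-LOCUS** (top version, the `(19,1)` END profile). [this work] -/
theorem mem_twentyLocus_of_nullTop_alternations (δ : Fin 6 → ℝ) (hd : StrictMono δ) (S : Fin 6 → Matrix (Fin 2) (Fin 2) ℝ)
    (hS : ∀ l, (S l).IsSymm) (h5 : (S 5).det = 0) (htr : (S 5).trace ≠ 0)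
    (τ : Fin 20 → ℝ) (hτ : StrictMono τ)
    (halt : ∀ j : Fin 19, (∑ l, Real.exp (δ l * τ j.castSucc) • S l).det * (∑ l, Real.exp (δ l * τ j.succ) • S l).det < 0) :
    δ ∈ TwentyLocus := by
  have hne : ∀ j : Fin 20, (∑ l, Real.exp (δ l * τ j) • S l).det ≠ 0 := by
    intro j
    by_cases hj : j = Fin.last 19
    · subst hj
      have := halt (Fin.last 18)
      rw [Fin.succ_last] at this
      intro hz; rw [hz, mul_zero] at this; exact lt_irrefl _ this
    · obtain ⟨i, rfl⟩ := Fin.exists_castSucc_eq.mpr hj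
      have := halt i
      intro hz; rw [hz, zero_mul] at this; exact lt_irrefl _ this
  obtain ⟨η, τ', hτ', -, halt'⟩ := extend_top_exp δ hd S h5 htr τ hτ hne halt
  set S' := Function.update S 5 (S 5 + η • (1 : Matrix (Fin 2) (Fin 2) ℝ)) with hS'
  refine ⟨S', NullEnd.isSymm_update S hS 5 η, ?_⟩
  rw [ncard_rpow_eq_ncard_exp]
  exact (le_ncard_of_alternations_exp δ S' (by norm_num) τ' hτ' halt').2

/-- **NULL-NULL EIGHTEEN WITH SIMPLE ZEROS ⇒ TWENTY-LOCUS** (both ends; the `(1,18,1)`-type shape and the refutation target of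
`Theorems/DoorA26/Negative/DoorA26FalseOfNullNullEighteen.lean` in real-exponent currency). [this work] -/
theorem mem_twentyLocus_of_nullNull_alternations (δ : Fin 6 → ℝ) (hd : StrictMono δ) (S : Fin 6 → Matrix (Fin 2) (Fin 2) ℝ)
    (hS : ∀ l, (S l).IsSymm) (h0 : (S 0).det = 0) (htr0 : (S 0).trace ≠ 0) (h5 : (S 5).det = 0) (htr5 : (S 5).trace ≠ 0)
    (τ : Fin 19 → ℝ) (hτ : StrictMono τ)
    (halt : ∀ j : Fin 18, (∑ l, Real.exp (δ l * τ j.castSucc) • S l).det * (∑ l, Real.exp (δ l * τ j.succ) • S l).det < 0) :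
    δ ∈ TwentyLocus := by
  have hne : ∀ j : Fin 19, (∑ l, Real.exp (δ l * τ j) • S l).det ≠ 0 := by
    intro j
    by_cases hj : j = Fin.last 18
    · subst hj
      have := halt (Fin.last 17)
      rw [Fin.succ_last] at this
      intro hz; rw [hz, mul_zero] at this; exact lt_irrefl _ this
    · obtain ⟨i, rfl⟩ := Fin.exists_castSucc_eq.mpr hj
      have := halt i
      intro hz; rw [hz, zero_mul] at this; exact lt_irrefl _ this
  obtain ⟨η₁, τ₁, hτ₁, hne₁, halt₁⟩ := extend_top_exp δ hd S h5 htr5 τ hτ hne halt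
  set S₁ := Function.update S 5 (S 5 + η₁ • (1 : Matrix (Fin 2) (Fin 2) ℝ)) with hS₁
  have hS₁0 : S₁ 0 = S 0 := by rw [hS₁, Function.update_of_ne (by decide)]
  have hS₁sym : ∀ l, (S₁ l).IsSymm := NullEnd.isSymm_update S hS 5 η₁
  obtain ⟨η₂, τ₂, hτ₂, -, halt₂⟩ :=
    extend_bot_exp δ hd S₁ (by rw [hS₁0]; exact h0) (by rw [hS₁0]; exact htr0) τ₁ hτ₁ hne₁ halt₁
  set S₂ := Function.update S₁ 0 (S₁ 0 + η₂ • (1 : Matrix (Fin 2) (Fin 2) ℝ)) with hS₂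
  refine ⟨S₂, NullEnd.isSymm_update S₁ hS₁sym 0 η₂, ?_⟩
  rw [ncard_rpow_eq_ncard_exp]
  exact (le_ncard_of_alternations_exp δ S₂ (by norm_num) τ₂ hτ₂ halt₂).2

end Summit.ValiantsHypothesis.ValiantsHypothesis.Theorems.LacunarySymmetroidMatrixDescartes.WallBubbling
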